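import Summits.Ventures.PercRepro2.CaseOnePendantQ
import Summits.Ventures.PercRepro2.CaseOneGadgetUWA1MainI
import Summits.Ventures.PercRepro2.CaseOneGadgetUWA1MainIQ

/-!
# The gadget `u ~ {w, a₁}`, `w ~ {u, a₂, o, b}` (uwa1): `a₃` pendant at `u`, the `(i)` side
(blind cell PercRepro2, p1 g23; S5 §2.1 (K9): the pendant lemma closed at a uwa1-gadget vertex on the `(i)` side)

The pendant lemma (K8, `zSplitI_of_leaf_at`) reads `(i)(a₃) ⟸ (i)(u) ∧ (i-Q)(u)` for `a₃` a leaf at `u` of any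
weight, and the Q-side (`zSplitIQ_of_leaf_at`) `(i-Q)(a₃) ⟸ (i-Q)(u)`; at a uwa1-gadget vertex both brackets are
theorems in `G − e₀` (`zSplitI_of_gadgetUWA1`, `zSplitIQ_of_gadgetUWA1`) and transfer to `G` by the leaf-deletion
identities (`zSplitI_of_restrict`, `zSplitIQ_of_restrict`). Hence **`(i)` and `(i-Q)` for `a₃` pendant at a
uwa1-gadget vertex** (`zSplitI_of_leaf_gadgetUWA1`, `zSplitIQ_of_leaf_gadgetUWA1`: the subtype form, `u` a gadget
vertex in `G − e₀`), and the description `IsPendantGadgetUWA1At` of this class in `G` itself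
(`zSplitI_of_pendantGadgetUWA1`, `zSplitIQ_of_pendantGadgetUWA1`). The `(ii)` side of the uwa1 row is not tree
(the face induction of the `(ii)` / `(ii-Q)` certificates is open), so no `(J1₁)` / `(RV)` is claimed here.
Own code; standard axioms. -/

namespace Summit.Ventures.PercRepro2

namespace CaseOne

section Pendant
variable {V : Type*} {E : Type*} [Fintype E] [DecidableEq E] [Fintype V] [DecidableEq V]
  {R : Type*} [Field R] [LinearOrder R] [IsStrictOrderedRing R]
variable {ends : E → Sym2 V} {o a₁ a₂ b u w a₃ : V} {e₀ : E}

/-- **`(i)` for `a₃` pendant at a uwa1-gadget vertex**: `a₃` is a leaf at `u` (edge `e₀`), and in `G − e₀` the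
vertex `u` is a uwa1-gadget vertex; every weight vector (the weight of `e₀` included). -/
theorem zSplitI_of_leaf_gadgetUWA1 (p : E → R) (hp : IsProbVec p) (hl : IsLeafAt ends u a₃ e₀)
    (ho : o ≠ a₃) (h1 : a₁ ≠ a₃) (h2 : a₂ ≠ a₃) (hb : b ≠ a₃)
    {euw eua1 ewa2 ewo ewb : {e : E // e ≠ e₀}}
    (h : IsGadgetUWA1 (restrictEnds ends e₀) o a₁ a₂ b u w euw eua1 ewa2 ewo ewb) :
    ZSplitI p ends o a₁ a₂ a₃ b :=
  zSplitI_of_leaf_at p hp hl o a₁ a₂ b ho h1 h2 hb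
    (zSplitI_of_restrict p hl ho h1 h2 hl.ne hb
      (zSplitI_of_gadgetUWA1 (restrictW p e₀) (IsProbVec.restrictW hp e₀) h))
    (zSplitIQ_of_restrict p hl ho h1 h2 hl.ne hb
      (zSplitIQ_of_gadgetUWA1 (restrictW p e₀) (IsProbVec.restrictW hp e₀) h))

/-- **`(i-Q)` for `a₃` pendant at a uwa1-gadget vertex**: the Q-threshold form scales down the leaf edge. -/
theorem zSplitIQ_of_leaf_gadgetUWA1 (p : E → R) (hp : IsProbVec p) (hl : IsLeafAt ends u a₃ e₀)
    (ho : o ≠ a₃) (h1 : a₁ ≠ a₃) (h2 : a₂ ≠ a₃) (hb : b ≠ a₃)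
    {euw eua1 ewa2 ewo ewb : {e : E // e ≠ e₀}}
    (h : IsGadgetUWA1 (restrictEnds ends e₀) o a₁ a₂ b u w euw eua1 ewa2 ewo ewb) :
    ZSplitIQ p ends o a₁ a₂ a₃ b :=
  zSplitIQ_of_leaf_at p hp hl o a₁ a₂ b ho h1 h2 hb
    (zSplitIQ_of_restrict p hl ho h1 h2 hl.ne hb
      (zSplitIQ_of_gadgetUWA1 (restrictW p e₀) (IsProbVec.restrictW hp e₀) h))

end Pendant

section SixEdges
variable {V : Type*} {E : Type*}

/-- **The pendant uwa1 gadget**: `a₃` is a leaf at `u` through `e₀`, the other edges at `u` are exactly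
`euw = {w, u}` and `eua1 = {a₁, u}`, and the edges at `w` are exactly `euw`, `ewa2 = {a₂, w}`, `ewo = {o, w}`,
`ewb = {b, w}` (five distinct edges), with the vertex inequalities of `IsGadgetUWA1` and `a₁, a₂, o, b, w ≠ a₃`. -/
structure IsPendantGadgetUWA1At (ends : E → Sym2 V) (o a₁ a₂ b u w a₃ : V)
    (e₀ euw eua1 ewa2 ewo ewb : E) : Prop where
  /-- the leaf -/
  leaf : IsLeafAt ends u a₃ e₀
  /-- the edge `{w, u}` -/
  ends_uw : ends euw = s(w, u)
  /-- the edge `{a₁, u}` -/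
  ends_ua1 : ends eua1 = s(a₁, u)
  /-- the edge `{a₂, w}` -/
  ends_wa2 : ends ewa2 = s(a₂, w)
  /-- the edge `{o, w}` -/
  ends_wo : ends ewo = s(o, w)
  /-- the edge `{b, w}` -/
  ends_wb : ends ewb = s(b, w)
  /-- distinct edges -/
  ne_uw_ua1 : euw ≠ eua1
  /-- distinct edges -/
  ne_uw_wa2 : euw ≠ ewa2
  /-- distinct edges -/
  ne_uw_wo : euw ≠ ewo
  /-- distinct edges -/
  ne_uw_wb : euw ≠ ewb
  /-- distinct edges -/
  ne_ua1_wa2 : eua1 ≠ ewa2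
  /-- distinct edges -/
  ne_ua1_wo : eua1 ≠ ewo
  /-- distinct edges -/
  ne_ua1_wb : eua1 ≠ ewb
  /-- distinct edges -/
  ne_wa2_wo : ewa2 ≠ ewo
  /-- distinct edges -/
  ne_wa2_wb : ewa2 ≠ ewb
  /-- distinct edges -/
  ne_wo_wb : ewo ≠ ewb
  /-- no other edge at `u` -/
  unique_u : ∀ e, u ∈ ends e → e = e₀ ∨ e = euw ∨ e = eua1
  /-- no other edge at `w` -/
  unique_w : ∀ e, w ∈ ends e → e = euw ∨ e = ewa2 ∨ e = ewo ∨ e = ewb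
  /-- `w ≠ u` -/
  ne_wu : w ≠ u
  /-- `o ≠ u` -/
  ne_ou : o ≠ u
  /-- `b ≠ u` -/
  ne_bu : b ≠ u
  /-- `a₁ ≠ u` -/
  ne_a1u : a₁ ≠ u
  /-- `a₂ ≠ u` -/
  ne_a2u : a₂ ≠ u
  /-- `a₁ ≠ w` -/
  ne_a1w : a₁ ≠ w
  /-- `a₂ ≠ w` -/
  ne_a2w : a₂ ≠ w
  /-- `o ≠ w` -/
  ne_ow : o ≠ w
  /-- `b ≠ w` -/
  ne_bw : b ≠ w
  /-- `a₁ ≠ a₃` -/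
  ne_a1' : a₁ ≠ a₃
  /-- `a₂ ≠ a₃` -/
  ne_a2' : a₂ ≠ a₃
  /-- `o ≠ a₃` -/
  ne_o' : o ≠ a₃
  /-- `b ≠ a₃` -/
  ne_b' : b ≠ a₃
  /-- `w ≠ a₃` -/
  ne_w' : w ≠ a₃

variable {ends : E → Sym2 V} {o a₁ a₂ b u w a₃ : V} {e₀ euw eua1 ewa2 ewo ewb : E}

/-- In `G − e₀` the vertex `u` of a pendant uwa1 gadget is a uwa1-gadget vertex. -/
theorem IsPendantGadgetUWA1At.gadgetUWA1
    (h : IsPendantGadgetUWA1At ends o a₁ a₂ b u w a₃ e₀ euw eua1 ewa2 ewo ewb) :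
    IsGadgetUWA1 (restrictEnds ends e₀) o a₁ a₂ b u w
      ⟨euw, ne_leaf_edge_of_ends h.leaf h.ends_uw h.ne_w'⟩
      ⟨eua1, ne_leaf_edge_of_ends h.leaf h.ends_ua1 h.ne_a1'⟩
      ⟨ewa2, ne_leaf_edge_of_ends' h.leaf h.ends_wa2 h.ne_a2u h.ne_wu⟩
      ⟨ewo, ne_leaf_edge_of_ends' h.leaf h.ends_wo h.ne_ou h.ne_wu⟩
      ⟨ewb, ne_leaf_edge_of_ends' h.leaf h.ends_wb h.ne_bu h.ne_wu⟩ where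
  ends_uw := h.ends_uw
  ends_ua1 := h.ends_ua1
  ends_wa2 := h.ends_wa2
  ends_wo := h.ends_wo
  ends_wb := h.ends_wb
  ne_uw_ua1 := fun h' => h.ne_uw_ua1 (congrArg Subtype.val h')
  ne_uw_wa2 := fun h' => h.ne_uw_wa2 (congrArg Subtype.val h')
  ne_uw_wo := fun h' => h.ne_uw_wo (congrArg Subtype.val h')
  ne_uw_wb := fun h' => h.ne_uw_wb (congrArg Subtype.val h')
  ne_ua1_wa2 := fun h' => h.ne_ua1_wa2 (congrArg Subtype.val h')
  ne_ua1_wo := fun h' => h.ne_ua1_wo (congrArg Subtype.val h')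
  ne_ua1_wb := fun h' => h.ne_ua1_wb (congrArg Subtype.val h')
  ne_wa2_wo := fun h' => h.ne_wa2_wo (congrArg Subtype.val h')
  ne_wa2_wb := fun h' => h.ne_wa2_wb (congrArg Subtype.val h')
  ne_wo_wb := fun h' => h.ne_wo_wb (congrArg Subtype.val h')
  unique_u := by
    rintro ⟨e, he0⟩ hu
    rcases h.unique_u e hu with rfl | rfl | rfl
    · exact absurd rfl he0
    · exact Or.inl rfl
    · exact Or.inr rfl
  unique_w := by
    rintro ⟨e, _⟩ hw
    rcases h.unique_w e hw with rfl | rfl | rfl | rfl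
    · exact Or.inl rfl
    · exact Or.inr (Or.inl rfl)
    · exact Or.inr (Or.inr (Or.inl rfl))
    · exact Or.inr (Or.inr (Or.inr rfl))
  ne_wu := h.ne_wu
  ne_ou := h.ne_ou
  ne_bu := h.ne_bu
  ne_a1u := h.ne_a1u
  ne_a2u := h.ne_a2u
  ne_a1w := h.ne_a1w
  ne_a2w := h.ne_a2w
  ne_ow := h.ne_ow
  ne_bw := h.ne_bw

end SixEdges

section PendantSix
variable {V : Type*} {E : Type*} [Fintype E] [DecidableEq E] [Fintype V] [DecidableEq V]
  {R : Type*} [Field R] [LinearOrder R] [IsStrictOrderedRing R]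
variable {ends : E → Sym2 V} {o a₁ a₂ b u w a₃ : V} {e₀ euw eua1 ewa2 ewo ewb : E}

/-- **`(i)` for the pendant uwa1 gadget in `G`**: `a₃` a leaf at `u`, `u` adjacent to `a₃, w, a₁` and nothing
else, `w` adjacent to `u, a₂, o, b` and nothing else; every finite graph, every weight vector. -/
theorem zSplitI_of_pendantGadgetUWA1 (p : E → R) (hp : IsProbVec p)
    (h : IsPendantGadgetUWA1At ends o a₁ a₂ b u w a₃ e₀ euw eua1 ewa2 ewo ewb) :
    ZSplitI p ends o a₁ a₂ a₃ b :=
  zSplitI_of_leaf_gadgetUWA1 p hp h.leaf h.ne_o' h.ne_a1' h.ne_a2' h.ne_b' h.gadgetUWA1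

/-- **`(i-Q)` for the pendant uwa1 gadget in `G`.** -/
theorem zSplitIQ_of_pendantGadgetUWA1 (p : E → R) (hp : IsProbVec p)
    (h : IsPendantGadgetUWA1At ends o a₁ a₂ b u w a₃ e₀ euw eua1 ewa2 ewo ewb) :
    ZSplitIQ p ends o a₁ a₂ a₃ b :=
  zSplitIQ_of_leaf_gadgetUWA1 p hp h.leaf h.ne_o' h.ne_a1' h.ne_a2' h.ne_b' h.gadgetUWA1

end PendantSix

end CaseOne

end Summit.Ventures.PercRepro2
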